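import Summits.Ventures.PackingBounds.ThreePointCert.CheckSym2Split
import Summits.Ventures.PackingBounds.ThreePointCert.CheckKron

/-!
# Three-point certificate theorems from plain nonnegativity of the multiplier expansions

Framing: lottery ticket; floor = certified bounds/negative ranges. Venture `PackingBounds`
(cell `pub-packcert`), three-point SDP family.

`ThreePointCert.Soundness.PolysOK3` packages, for each of the seven sums-of-squares multiplier
expansions `E₀ … E₄, E_{Q0}, E_{Q1}` of a certificate, a validated MONOMIAL-basis Gram block
(`RValid g E`). The soundness proofs (`AF3_of_check`, `FII3S2_of_checkSplit`,
`card_le_of_cert3S2split`) use these hypotheses only through `eval_nonneg_of_rvalid`, i.e. through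
`0 ≤ E(u,v,t)` on the unit box. This file restates the three theorems with exactly that weaker
hypothesis (`PolysNN3`: `BoxNonneg E` for the seven expansions, plus the unchanged `FI` validity),
so that an expansion can be supplied as a nonnegative INTEGER MULTIPLE of a validated Gram form
(`boxNonneg_smul`: `E = c • E'`, `E' = zᵀ(L'L'ᵀ)z` validated by `ThreePointCert.CheckKron` with COARSE
factor rows `L' ≈ L/2^k` — the Gram factors need far fewer bits than the common unit `D²·W` of the
identity suggests, which cuts the data of a kernel row by ≈ 40 %), as a sum of validated blocks
(`boxNonneg_append`), or from any future validation scheme. The proofs are those of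
`CheckSym2Split` / `Soundness` verbatim with the nonnegativity facts taken from the hypothesis;
the data format `Cert3` / `CertPolys3`, the checks `checkI3`, `checkII3S2a/b/c`, `checkSide3`,
`checkBound3` and the final statement are unchanged (`PolysNN3.of_ok3` recovers the old hypothesis).

## References
* C. Bachoc, F. Vallentin, New upper bounds for kissing numbers from semidefinite programming,
  J. Amer. Math. Soc. 21 (2008) 909–924, Theorem 4.2 and (10). [`BachocVallentin2007`]
-/

noncomputable section

open Finset
open scoped RealInnerProductSpace

namespace Summit.Ventures.PackingBounds.ThreePointCert

open Literature.Geometry.DiscreteGeometry Literature.Geometry.DiscreteGeometry.PolyCert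
open Literature.Geometry.DiscreteGeometry.PolyCert.SPoly
open Literature.Analysis.SpecialFunctions

/-- Nonnegativity on the unit box of a term list (the form in which validated expansions are used). -/
def BoxNonneg (R : SPoly) : Prop :=
  ∀ u v t : ℝ, |u| ≤ 1 → |v| ≤ 1 → |t| ≤ 1 → 0 ≤ eval R u v t

/-- A validated monomial-basis Gram expansion (`ThreePointCert.Soundness.RValid`) is `BoxNonneg`. -/
theorem boxNonneg_of_rvalid (g : GramBlk) (R : SPoly) (h : RValid g R) : BoxNonneg R :=
  fun u v t hu hv ht => eval_nonneg_of_rvalid g R h u v t hu hv ht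

/-- `BoxNonneg` from a single packed chunk check (`ThreePointCert.CheckKron`). -/
theorem boxNonneg_of_singleK (g : GramBlkK) (R : SPoly) (h : chunkOKK g 0 g.z.length [] R = true) :
    BoxNonneg R :=
  boxNonneg_of_rvalid g.toGramBlk R (rvalid_of_singleK g R h)

/-- A nonnegative integer multiple of a `BoxNonneg` term list is `BoxNonneg` (coarse Gram factors:
`E = 4^k • zᵀ(L'L'ᵀ)z`). -/
theorem boxNonneg_smul (c : ℕ) (R : SPoly) (h : BoxNonneg R) : BoxNonneg (smul (c : ℤ) R) :=
  fun u v t hu hv ht => by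
    rw [eval_smul]; exact mul_nonneg (by exact_mod_cast Nat.zero_le c) (h u v t hu hv ht)

/-- The concatenation (sum) of two `BoxNonneg` term lists is `BoxNonneg` (block-diagonal expansions). -/
theorem boxNonneg_append (R₁ R₂ : SPoly) (h₁ : BoxNonneg R₁) (h₂ : BoxNonneg R₂) : BoxNonneg (R₁ ++ R₂) :=
  fun u v t hu hv ht => by rw [eval_append]; exact add_nonneg (h₁ u v t hu hv ht) (h₂ u v t hu hv ht)

/-- The expansion data of a certificate are valid in the weak sense actually used by the soundness
proofs: the `FI` expansion is exact on the box and the seven multiplier expansions are nonnegative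
on the unit box. -/
structure PolysNN3 (c : Cert3) (P : CertPolys3) : Prop where
  /-- `FI` expansion valid -/
  hF : FexpValidG c P.FP
  /-- expansion for multiplier `1` of `(ii')` is `≥ 0` on the box -/
  h0 : BoxNonneg P.E0
  /-- expansion for the coset multiplier `g_q` (or `m₁`) -/
  h1 : BoxNonneg P.E1
  /-- expansion for multiplier `m₂` -/
  h2 : BoxNonneg P.E2
  /-- expansion for multiplier `m₃` -/
  h3 : BoxNonneg P.E3
  /-- expansion for multiplier `s₄` -/
  h4 : BoxNonneg P.E4
  /-- expansion for multiplier `1` of `(i')` -/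
  hq0 : BoxNonneg P.EQ0
  /-- expansion for multiplier `g_q(u)` of `(i')` -/
  hq1 : BoxNonneg P.EQ1

/-- The monomial-basis validity package implies the weak one. -/
theorem PolysNN3.of_ok3 {c : Cert3} {P : CertPolys3} {g0 g1 g2 g3 g4 q0 q1 : GramBlk}
    (hP : PolysOK3 c P g0 g1 g2 g3 g4 q0 q1) : PolysNN3 c P where
  hF := hP.hF
  h0 := boxNonneg_of_rvalid g0 _ hP.h0
  h1 := boxNonneg_of_rvalid g1 _ hP.h1
  h2 := boxNonneg_of_rvalid g2 _ hP.h2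
  h3 := boxNonneg_of_rvalid g3 _ hP.h3
  h4 := boxNonneg_of_rvalid g4 _ hP.h4
  hq0 := boxNonneg_of_rvalid q0 _ hP.hq0
  hq1 := boxNonneg_of_rvalid q1 _ hP.hq1

/-- The `sym2` right-hand side of `(ii')` is nonnegative on the domain `D'` when the five
expansions are nonnegative on the box. -/
theorem rhsII3S2_nonnegNN (c : Cert3) (P : CertPolys3) (hP : PolysNN3 c P) (hq : 0 < c.q)
    (hpq : c.p ≤ (c.q : ℤ)) (u v t : ℝ)
    (hu : -1 ≤ u) (hu' : u ≤ (c.p : ℝ) / c.q) (hv : -1 ≤ v) (hv' : v ≤ (c.p : ℝ) / c.q)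
    (ht : -1 ≤ t) (ht' : t ≤ (c.p : ℝ) / c.q)
    (hp : 0 ≤ 1 + 2 * u * v * t - u ^ 2 - v ^ 2 - t ^ 2) :
    0 ≤ eval (rhsII3S2 c P) u v t := by
  have hu1 := abs_le_one_of_box c.p c.q hq hpq u hu hu'
  have hv1 := abs_le_one_of_box c.p c.q hq hpq v hv hv'
  have ht1 := abs_le_one_of_box c.p c.q hq hpq t ht ht'
  have gu := gq_nonneg c.p c.q u hu (qmul_le_of_box c.p c.q hq u hu')
  have gv := gq_nonneg c.p c.q v hv (qmul_le_of_box c.p c.q hq v hv')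
  have gt := gq_nonneg c.p c.q t ht (qmul_le_of_box c.p c.q hq t ht')
  have e0 := hP.h0 u v t hu1 hv1 ht1
  have e1 := hP.h1 u v t hu1 hv1 ht1
  have e1' := hP.h1 v u t hv1 hu1 ht1
  have e1'' := hP.h1 t v u ht1 hv1 hu1
  have e2 := hP.h2 u v t hu1 hv1 ht1
  have e3 := hP.h3 u v t hu1 hv1 ht1
  have e4 := hP.h4 u v t hu1 hv1 ht1
  rw [rhsII3S2, eval_mergeAll]
  simp only [List.map_cons, List.map_nil, List.sum_cons, List.sum_nil, add_zero, eval_mulN,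
    eval_permBAC, eval_permCBA, eval_gE1, eval_m2P, eval_m3P, eval_p4]
  generalize eval P.E0 u v t = r0 at *
  generalize eval P.E1 u v t = r1 at *
  generalize eval P.E1 v u t = r1' at *
  generalize eval P.E1 t v u = r1'' at *
  generalize eval P.E2 u v t = r2 at *
  generalize eval P.E3 u v t = r3 at *
  generalize eval P.E4 u v t = r4 at *
  generalize (u + 1) * ((c.p : ℝ) - c.q * u) = a1 at *
  generalize (v + 1) * ((c.p : ℝ) - c.q * v) = a2 at *
  generalize (t + 1) * ((c.p : ℝ) - c.q * t) = a3 at *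
  have m12 := mul_nonneg gu gv
  have m13 := mul_nonneg gu gt
  have m23 := mul_nonneg gv gt
  have m123 := mul_nonneg gu (mul_nonneg gv gt)
  nlinarith [mul_nonneg gu e1, mul_nonneg gv e1', mul_nonneg gt e1'', mul_nonneg m12 e2,
    mul_nonneg m13 e2, mul_nonneg m23 e2, mul_nonneg m123 e3, mul_nonneg hp e4]

set_option maxHeartbeats 4000000 in
/-- Soundness of `(ii')` in mode `sym2` from the three split checks, weak hypothesis: on `D'`,
`F ≤ -b₂₂` (in units: `FvalG/D² ≤ -B22/(D²W)`), for any intermediate polynomials `M`, `M'`. -/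
theorem FII3S2_of_checkSplitNN (c : Cert3) (P : CertPolys3) (hP : PolysNN3 c P) (M M' : SPoly)
    (ha : checkII3S2a c P M = true) (hb : checkII3S2b c P M M' = true)
    (hc : checkII3S2c c P M' = true) (hs : checkSide3 c = true) (u v t : ℝ)
    (hu : -1 ≤ u) (hu' : u ≤ (c.p : ℝ) / c.q) (hv : -1 ≤ v) (hv' : v ≤ (c.p : ℝ) / c.q)
    (ht : -1 ≤ t) (ht' : t ≤ (c.p : ℝ) / c.q)
    (hp : 0 ≤ 1 + 2 * u * v * t - u ^ 2 - v ^ 2 - t ^ 2) :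
    FvalG c.n c.F u v t / 2 ^ (2 * c.S) ≤ -((c.B22 : ℝ) / c.DDW) := by
  obtain ⟨hn, hq, hpq, _, hAlen, hFk, _⟩ := side_of_check c hs
  have hu1 := abs_le_one_of_box c.p c.q hq hpq u hu hu'
  have hv1 := abs_le_one_of_box c.p c.q hq hpq v hv hv'
  have ht1 := abs_le_one_of_box c.p c.q hq hpq t ht ht'
  have ra := abs_eval_le_of_residualBound _ _ ha hu1 hv1 ht1
  have rb := abs_eval_le_of_residualBound _ _ hb hu1 hv1 ht1
  have rc := abs_eval_le_of_residualBound _ _ hc hu1 hv1 ht1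
  rw [eval_mergeAll] at ra rb rc
  simp only [List.map_cons, List.map_nil, List.sum_cons, List.sum_nil, add_zero, eval_neg, eval_C,
    Int.cast_natCast, Nat.cast_zero] at ra rb rc
  have hrhs : 0 ≤ eval (rhsII3S2 c P) u v t :=
    rhsII3S2_nonnegNN c P hP hq hpq u v t hu hu' hv hv' ht ht' hp
  rw [rhsII3S2, eval_mergeAll] at hrhs
  simp only [List.map_cons, List.map_nil, List.sum_cons, List.sum_nil, add_zero] at hrhs
  have htgt : 0 ≤ eval (targetII3 c P) u v t := by
    have a1 := (abs_le.1 ra).1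
    have b1 := (abs_le.1 rb).1
    have b2 := (abs_le.1 rb).2
    have c1 := (abs_le.1 rc).1
    linarith
  rw [targetII3, eval_neg, eval_append, eval_C, hP.hF u v t hu1 hv1 ht1,
    eval_FPolyG c.n c.d c.F hFk] at htgt
  push_cast at htgt
  have hW : (0 : ℝ) < Wfac c.d := by exact_mod_cast Wfac_pos c.d
  have hD : (0 : ℝ) < 2 ^ (2 * c.S) := pow_pos (by norm_num) _
  have hDDW : (c.DDW : ℝ) = 2 ^ (2 * c.S) * (Wfac c.d : ℝ) := by simp [Cert3.DDW]
  have key : FvalG c.n c.F u v t * (Wfac c.d : ℝ) ≤ -(c.B22 : ℝ) := by linarith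
  rw [hDDW, div_le_iff₀ hD]
  have e : -((c.B22 : ℝ) / (2 ^ (2 * c.S) * Wfac c.d)) * 2 ^ (2 * c.S) = -(c.B22 : ℝ) / Wfac c.d := by
    field_simp
  rw [e, le_div_iff₀ hW]
  exact key

set_option maxHeartbeats 4000000 in
/-- Soundness of `(i')`, weak hypothesis: on `[-1, s]`, `A(u) + 3F(u,u,1) ≤ -1 - 2b₁₂ - b₂₂` (in units). -/
theorem AF3_of_checkNN (c : Cert3) (P : CertPolys3) (hP : PolysNN3 c P) (h : checkI3 c P = true)
    (hs : checkSide3 c = true) (u : ℝ) (hu : -1 ≤ u) (hu' : u ≤ (c.p : ℝ) / c.q) :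
    AvalG c.n c.A u / 2 ^ (2 * c.S) + 3 * (FvalG c.n c.F u u 1 / 2 ^ (2 * c.S)) ≤
      -1 - 2 * ((c.B12 : ℝ) / c.DDW) - (c.B22 : ℝ) / c.DDW := by
  obtain ⟨hn, hq, hpq, _, hAlen, hFk, _⟩ := side_of_check c hs
  have hu1 := abs_le_one_of_box c.p c.q hq hpq u hu hu'
  have h01 : |(0 : ℝ)| ≤ 1 := by norm_num
  have h11 : |(1 : ℝ)| ≤ 1 := by norm_num
  have gu := gq_nonneg c.p c.q u hu (qmul_le_of_box c.p c.q hq u hu')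
  have hres := abs_eval_le_of_residualBound _ _ h hu1 h01 h01
  rw [eval_mergeAll] at hres
  simp only [List.map_cons, List.map_nil, List.sum_cons, List.sum_nil, add_zero, eval_neg, eval_C,
    Int.cast_natCast] at hres
  have hrhs : 0 ≤ eval (rhsI3 c P) u 0 0 := by
    have e0 := hP.hq0 u 0 0 hu1 h01 h01
    have e1 := hP.hq1 u 0 0 hu1 h01 h01
    rw [rhsI3, eval_mergeAll]
    simp only [List.map_cons, List.map_nil, List.sum_cons, List.sum_nil, add_zero, eval_mulN,
      eval_gqU]
    nlinarith [mul_nonneg gu e1]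
  generalize hR : eval (rhsI3 c P) u 0 0 = R at hres hrhs
  have htgt : 0 ≤ eval (targetI3 c P) u 0 0 := by
    have h1 := (abs_le.1 hres).1
    linarith
  have hFss : eval (substUU1 P.FP) u 0 0 = (Wfac c.d : ℝ) * FvalG c.n c.F u u 1 := by
    rw [eval_substUU1, hP.hF u u 1 hu1 hu1 h11, eval_FPolyG c.n c.d c.F hFk]
  rw [targetI3, eval_neg, eval_append, eval_append, eval_C, eval_smul, hFss,
    eval_APolyG c.n c.d c.A hAlen.le] at htgt
  push_cast at htgt
  have hW : (0 : ℝ) < Wfac c.d := by exact_mod_cast Wfac_pos c.d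
  have hD : (0 : ℝ) < 2 ^ (2 * c.S) := pow_pos (by norm_num) _
  have hDDW : (c.DDW : ℝ) = 2 ^ (2 * c.S) * (Wfac c.d : ℝ) := by simp [Cert3.DDW]
  rw [hDDW] at htgt ⊢
  have hDW : (0 : ℝ) < 2 ^ (2 * c.S) * (Wfac c.d : ℝ) := mul_pos hD hW
  generalize hAv : AvalG c.n c.A u = AV at htgt ⊢
  generalize hFv : FvalG c.n c.F u u 1 = FV at htgt ⊢
  have key : (Wfac c.d : ℝ) * (AV + 3 * FV) ≤
      -(2 ^ (2 * c.S) * (Wfac c.d : ℝ)) - 2 * (c.B12 : ℝ) - (c.B22 : ℝ) := by linarith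
  have lhs_eq : AV / 2 ^ (2 * c.S) + 3 * (FV / 2 ^ (2 * c.S)) =
      ((Wfac c.d : ℝ) * (AV + 3 * FV)) / (2 ^ (2 * c.S) * Wfac c.d) := by
    field_simp
  have rhs_eq : -1 - 2 * ((c.B12 : ℝ) / (2 ^ (2 * c.S) * Wfac c.d)) - (c.B22 : ℝ) / (2 ^ (2 * c.S) * Wfac c.d)
      = (-(2 ^ (2 * c.S) * (Wfac c.d : ℝ)) - 2 * (c.B12 : ℝ) - (c.B22 : ℝ)) / (2 ^ (2 * c.S) * Wfac c.d) := by
    field_simp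
  rw [lhs_eq, rhs_eq]
  exact div_le_div_of_nonneg_right key hDW.le

/-- **The bound from a checked certificate in Bachoc–Vallentin's own multiplier set** (mode
`sym2`, split check of `(ii')`) from the WEAK validity package `PolysNN3` (expansions nonnegative
on the box, e.g. a scaled validated Gram form `c • zᵀ(LLᵀ)z` via `boxNonneg_smul`);
otherwise exactly `card_le_of_cert3S2split`: every finite set of unit vectors of `ℝⁿ`
(`n = c.n ≥ 4`) with pairwise inner products `≤ c.p/c.q` has at most `c.N` elements. -/
theorem card_le_of_cert3S2splitNN (c : Cert3) (P : CertPolys3) (hP : PolysNN3 c P)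
    (hI : checkI3 c P = true) (M M' : SPoly)
    (ha : checkII3S2a c P M = true) (hb : checkII3S2b c P M M' = true)
    (hc : checkII3S2c c P M' = true) (hs : checkSide3 c = true) (hb3 : checkBound3 c P = true)
    (C : Finset (EuclideanSpace ℝ (Fin c.n))) (hC : ∀ x ∈ C, ‖x‖ = 1)
    (hcode : ∀ x ∈ C, ∀ y ∈ C, x ≠ y → inner ℝ x y ≤ (c.p : ℝ) / c.q) : C.card ≤ c.N := by
  obtain ⟨hn, hq, hpq, _, hAlen, hFk, _⟩ := side_of_check c hs
  have hbd := bound3_of_check c P hP.hF hs hb3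
  have hD : (0 : ℝ) < 2 ^ (2 * c.S) := pow_pos (by norm_num) _
  have hA : 0 ≤ BachocVallentin.pairSum C (fun u => AvalG c.n c.A u / 2 ^ (2 * c.S)) := by
    have h0 := pairSum_AvalG_nonneg (by omega : 3 ≤ c.n) c.A C hC
    unfold BachocVallentin.pairSum at h0 ⊢
    have e : (∑ x ∈ C, ∑ y ∈ C, AvalG c.n c.A (inner ℝ x y) / 2 ^ (2 * c.S)) =
        (∑ x ∈ C, ∑ y ∈ C, AvalG c.n c.A (inner ℝ x y)) / 2 ^ (2 * c.S) := by
      rw [Finset.sum_div]; refine Finset.sum_congr rfl fun x _ => ?_; rw [Finset.sum_div]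
    rw [e]; exact div_nonneg h0 hD.le
  have hF : 0 ≤ BachocVallentin.tripleSum C (fun u v t => FvalG c.n c.F u v t / 2 ^ (2 * c.S)) := by
    have h0 := tripleSum_FvalG_nonneg hn c.F C hC
    unfold BachocVallentin.tripleSum at h0 ⊢
    have e : (∑ x ∈ C, ∑ y ∈ C, ∑ z ∈ C,
        FvalG c.n c.F (inner ℝ x y) (inner ℝ x z) (inner ℝ y z) / 2 ^ (2 * c.S))
        = (∑ x ∈ C, ∑ y ∈ C, ∑ z ∈ C,
          FvalG c.n c.F (inner ℝ x y) (inner ℝ x z) (inner ℝ y z)) / 2 ^ (2 * c.S) := by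
      rw [Finset.sum_div]; refine Finset.sum_congr rfl fun x _ => ?_
      rw [Finset.sum_div]; refine Finset.sum_congr rfl fun y _ => ?_
      rw [Finset.sum_div]
    rw [e]; exact div_nonneg h0 hD.le
  have h := BachocVallentin.card_le_of_threePoint ((c.p : ℝ) / c.q) C hC hcode
    (fun u => AvalG c.n c.A u / 2 ^ (2 * c.S)) (fun u v t => FvalG c.n c.F u v t / 2 ^ (2 * c.S))
    ((c.B11 : ℝ) / c.DDW) ((c.B12 : ℝ) / c.DDW) ((c.B22 : ℝ) / c.DDW) hA hF
    (fun u v t => by rw [FvalG_swap12])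
    (fun u v t => by rw [FvalG_swap23])
    (bquad3_nonneg_of_check c hs)
    (fun u hu hu' => AF3_of_checkNN c P hP hI hs u hu hu')
    (fun u v t hu hu' hv hv' ht ht' hp =>
      FII3S2_of_checkSplitNN c P hP M M' ha hb hc hs u v t hu hu' hv hv' ht ht' hp)
    hbd.2
  have hlt : (C.card : ℝ) < (c.N : ℝ) + 1 := lt_of_le_of_lt h hbd.1
  have hlt' : C.card < c.N + 1 := by exact_mod_cast hlt
  omega

end Summit.Ventures.PackingBounds.ThreePointCert

end
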